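import Literature.NumberTheory.Rogawski1990.SingularObstruction
import Literature.NumberTheory.Automorphic.UnitaryGroupBlockCentralizer
import HarnessLib

/-!
# The block determinant in a frame: `blockDet e X = det X₁` when `P⁻¹ e P = 1 ⊕ᶠ 0` and `P⁻¹ X P = X₁ ⊕ᶠ X₂`
# (Rogawski 1990, §3.8 Prop. 3.8.1 p. 37 — the `U(2)`-block of the centraliser of a singular semisimple element)

Topic `NumberTheory/Rogawski1990`; namespace `Literature.NumberTheory.Rogawski1990`; **THEOREMS ONLY** (no definition, no named fact, no instance,
no notation, no `sorry`).  Cell `pub/hodgecm-mathlib`, ENGINE T1 (crux H413 = `stmt-HodgeConjecture-24833`), O7 singular classes: the BRIDGING LEMMA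
between the frame-free idempotent currency of ★ `SingularObstruction` (`blockDet e X := det (e X e + (1 − e))`, `e` the Lagrange idempotent
`(a − b)⁻¹ (γ − b)`) and the `finSum N₁ N₂` FRAME currency of the K1 road (★ `SingularSemisimpleFrame.exists_singular_frame`: `γ P = P (a·1 ⊕ᶠ b·1)`;
★ `eq_finSum_of_commute`: everything commuting with `γ` is `P (X₁ ⊕ᶠ X₂) P⁻¹`; ★ B-p14 `exists_commute_twistGram_eq_of_blocks` ∕ `…_of_det_blocks`),
asked for by F0P5a-p03's TRUNK WORDS #6∕#7 for the assembly `hreal` of the singular ObsHasse.  Any commutative ring `S`, any block sizes `N₁, N₂`.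

* `lagrangeIdem_mul_frame` — in a frame of `γ` the Lagrange idempotent is `1 ⊕ᶠ 0`: `(u • (γ − b•1)) P = P (1 ⊕ᶠ 0)` (`u (a − b) = 1`).
* **`blockDet_eq_det_of_frame`** — `e P = P (1 ⊕ᶠ 0)`, `X P = P (X₁ ⊕ᶠ X₂)` ⇒ `blockDet e X = det X₁`.
* **`blockDet_lagrangeIdem_eq_det`** — the two combined; **`exists_finSum_blockDet_lagrangeIdem_eq_det`** — for `X ∈ Z(γ)` the blocks exist (★
  `eq_finSum_of_commute`) and `blockDet e X = det X₁`; `blockDet_map` (★ `SingularObstructionVanishing`) then reads the adelic block determinant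
  place by place.

## References
* [Rogawski1990] J. D. Rogawski, *Automorphic Representations of Unitary Groups in Three Variables*, Ann. of Math. Stud. 123 (1990), §3.8 Prop. 3.8.1 p. 37.
* [Kottwitz1986] R. E. Kottwitz, *Stable trace formula: elliptic singular terms*, Math. Ann. 275 (1986), §9.
-/

set_option autoImplicit false

noncomputable section

open scoped Matrix MatrixGroups

namespace Literature.NumberTheory.Rogawski1990

open Literature.NumberTheory.Automorphic.UnitaryGroup (finSum eq_finSum_of_commute)

section Frame

variable {S : Type*} [CommRing S] {N₁ N₂ : ℕ}

/-- `(A ⊕ᶠ B)(C ⊕ᶠ D) = AC ⊕ᶠ BD`. [folklore] -/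
private theorem finSum_mul_finSum₀ (A C : Matrix (Fin N₁) (Fin N₁) S) (B D : Matrix (Fin N₂) (Fin N₂) S) :
    finSum N₁ N₂ A B * finSum N₁ N₂ C D = finSum N₁ N₂ (A * C) (B * D) := by
  simp only [finSum, Matrix.reindex_apply, Matrix.submatrix_mul_equiv, Matrix.fromBlocks_multiply, Matrix.mul_zero, Matrix.zero_mul,
    add_zero, zero_add]

/-- `(A ⊕ᶠ B) + (C ⊕ᶠ D) = (A + C) ⊕ᶠ (B + D)`. [folklore] -/
private theorem finSum_add_finSum₀ (A C : Matrix (Fin N₁) (Fin N₁) S) (B D : Matrix (Fin N₂) (Fin N₂) S) :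
    finSum N₁ N₂ A B + finSum N₁ N₂ C D = finSum N₁ N₂ (A + C) (B + D) := by
  have h : Matrix.fromBlocks (A + C) 0 0 (B + D) = Matrix.fromBlocks A 0 0 B + Matrix.fromBlocks C 0 0 D := by
    rw [Matrix.fromBlocks_add, add_zero, add_zero]
  ext i j
  simp only [finSum, Matrix.reindex_apply, Matrix.submatrix_apply, Matrix.add_apply, h]

/-- `(A ⊕ᶠ B) − (C ⊕ᶠ D) = (A − C) ⊕ᶠ (B − D)`. [folklore] -/
private theorem finSum_sub_finSum₀ (A C : Matrix (Fin N₁) (Fin N₁) S) (B D : Matrix (Fin N₂) (Fin N₂) S) :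
    finSum N₁ N₂ A B - finSum N₁ N₂ C D = finSum N₁ N₂ (A - C) (B - D) := by
  rw [sub_eq_iff_eq_add, finSum_add_finSum₀, sub_add_cancel, sub_add_cancel]

/-- `r • (A ⊕ᶠ B) = (r • A) ⊕ᶠ (r • B)`. [folklore] -/
private theorem smul_finSum₀ (r : S) (A : Matrix (Fin N₁) (Fin N₁) S) (B : Matrix (Fin N₂) (Fin N₂) S) :
    r • finSum N₁ N₂ A B = finSum N₁ N₂ (r • A) (r • B) := by
  have h : Matrix.fromBlocks (r • A) 0 0 (r • B) = r • Matrix.fromBlocks A 0 0 B := by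
    rw [Matrix.fromBlocks_smul, smul_zero, smul_zero]
  ext i j
  simp only [finSum, Matrix.reindex_apply, Matrix.submatrix_apply, Matrix.smul_apply, h]

/-- `1 ⊕ᶠ 1 = 1`. [folklore] -/
private theorem finSum_one_one₀ : finSum N₁ N₂ (1 : Matrix (Fin N₁) (Fin N₁) S) (1 : Matrix (Fin N₂) (Fin N₂) S) = 1 := by
  simp only [finSum, Matrix.reindex_apply, Matrix.fromBlocks_one, Matrix.submatrix_one_equiv]

/-- `det (A ⊕ᶠ B) = det A · det B`. [folklore] -/
private theorem det_finSum₀ (A : Matrix (Fin N₁) (Fin N₁) S) (B : Matrix (Fin N₂) (Fin N₂) S) :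
    (finSum N₁ N₂ A B).det = A.det * B.det := by
  rw [finSum, Matrix.det_reindex_self, Matrix.det_fromBlocks_zero₂₁]

/-- **In a frame of `γ` the Lagrange idempotent is `1 ⊕ᶠ 0`**: if `γ P = P (a·1 ⊕ᶠ b·1)` and `u (a − b) = 1` then
`(u • (γ − b•1)) P = P (1 ⊕ᶠ 0)`. [cite: Rogawski1990, §3.8 Prop. 3.8.1 p. 37] -/
theorem lagrangeIdem_mul_frame {γ P : Matrix (Fin (N₁ + N₂)) (Fin (N₁ + N₂)) S} {a b u : S}
    (hγP : γ * P = P * finSum N₁ N₂ (a • (1 : Matrix (Fin N₁) (Fin N₁) S)) (b • (1 : Matrix (Fin N₂) (Fin N₂) S))) (hu : u * (a - b) = 1) :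
    (u • (γ - b • (1 : Matrix (Fin (N₁ + N₂)) (Fin (N₁ + N₂)) S))) * P =
      P * finSum N₁ N₂ (1 : Matrix (Fin N₁) (Fin N₁) S) (0 : Matrix (Fin N₂) (Fin N₂) S) := by
  have hbP : (b • (1 : Matrix (Fin (N₁ + N₂)) (Fin (N₁ + N₂)) S)) * P =
      P * finSum N₁ N₂ (b • (1 : Matrix (Fin N₁) (Fin N₁) S)) (b • (1 : Matrix (Fin N₂) (Fin N₂) S)) := by
    rw [Matrix.smul_mul, Matrix.one_mul, ← smul_finSum₀, finSum_one_one₀, Matrix.mul_smul, Matrix.mul_one]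
  calc (u • (γ - b • (1 : Matrix (Fin (N₁ + N₂)) (Fin (N₁ + N₂)) S))) * P
        = u • (γ * P - (b • (1 : Matrix (Fin (N₁ + N₂)) (Fin (N₁ + N₂)) S)) * P) := by rw [Matrix.smul_mul, Matrix.sub_mul]
    _ = u • (P * (finSum N₁ N₂ (a • (1 : Matrix (Fin N₁) (Fin N₁) S)) (b • (1 : Matrix (Fin N₂) (Fin N₂) S)) -
          finSum N₁ N₂ (b • (1 : Matrix (Fin N₁) (Fin N₁) S)) (b • (1 : Matrix (Fin N₂) (Fin N₂) S)))) := by rw [hγP, hbP, Matrix.mul_sub]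
    _ = P * finSum N₁ N₂ ((u * (a - b)) • (1 : Matrix (Fin N₁) (Fin N₁) S)) ((u * (b - b)) • (1 : Matrix (Fin N₂) (Fin N₂) S)) := by
          rw [finSum_sub_finSum₀, ← sub_smul, ← sub_smul, ← Matrix.mul_smul, smul_finSum₀, smul_smul, smul_smul]
    _ = P * finSum N₁ N₂ (1 : Matrix (Fin N₁) (Fin N₁) S) (0 : Matrix (Fin N₂) (Fin N₂) S) := by rw [hu, sub_self, mul_zero, one_smul, zero_smul]

/-- **THE BRIDGE: `blockDet e X = det X₁` in a frame** — if `P` is invertible with `e P = P (1 ⊕ᶠ 0)` and `X P = P (X₁ ⊕ᶠ X₂)`, then the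
frame-free block determinant `det (e X e + (1 − e))` is the determinant of the first block. [cite: Rogawski1990, §3.8 Prop. 3.8.1 p. 37] -/
theorem blockDet_eq_det_of_frame {P : GL (Fin (N₁ + N₂)) S} {e X : Matrix (Fin (N₁ + N₂)) (Fin (N₁ + N₂)) S}
    {X₁ : Matrix (Fin N₁) (Fin N₁) S} {X₂ : Matrix (Fin N₂) (Fin N₂) S}
    (heP : e * (P : Matrix (Fin (N₁ + N₂)) (Fin (N₁ + N₂)) S) =
      (P : Matrix (Fin (N₁ + N₂)) (Fin (N₁ + N₂)) S) * finSum N₁ N₂ (1 : Matrix (Fin N₁) (Fin N₁) S) (0 : Matrix (Fin N₂) (Fin N₂) S))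
    (hXP : X * (P : Matrix (Fin (N₁ + N₂)) (Fin (N₁ + N₂)) S) = (P : Matrix (Fin (N₁ + N₂)) (Fin (N₁ + N₂)) S) * finSum N₁ N₂ X₁ X₂) :
    blockDet e X = X₁.det := by
  set Pm : Matrix (Fin (N₁ + N₂)) (Fin (N₁ + N₂)) S := (P : Matrix (Fin (N₁ + N₂)) (Fin (N₁ + N₂)) S) with hPm
  set Pi : Matrix (Fin (N₁ + N₂)) (Fin (N₁ + N₂)) S := ((P⁻¹ : GL (Fin (N₁ + N₂)) S) : Matrix (Fin (N₁ + N₂)) (Fin (N₁ + N₂)) S) with hPi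
  set E : Matrix (Fin (N₁ + N₂)) (Fin (N₁ + N₂)) S := finSum N₁ N₂ (1 : Matrix (Fin N₁) (Fin N₁) S) (0 : Matrix (Fin N₂) (Fin N₂) S) with hE
  have hPPi : Pm * Pi = 1 := by rw [hPm, hPi, ← Units.val_mul, mul_inv_cancel, Units.val_one]
  have hPiP : Pi * Pm = 1 := by rw [hPm, hPi, ← Units.val_mul, inv_mul_cancel, Units.val_one]
  -- `e = P E P⁻¹`, `X = P (X₁ ⊕ X₂) P⁻¹`
  have he : e = Pm * E * Pi := by rw [← heP, Matrix.mul_assoc, hPPi, Matrix.mul_one]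
  have hX : X = Pm * finSum N₁ N₂ X₁ X₂ * Pi := by rw [← hXP, Matrix.mul_assoc, hPPi, Matrix.mul_one]
  -- the truncation in the frame
  have htrunc : e * X * e + (1 - e) = Pm * finSum N₁ N₂ X₁ (1 : Matrix (Fin N₂) (Fin N₂) S) * Pi := by
    have h1 : e * X * e = Pm * (E * finSum N₁ N₂ X₁ X₂ * E) * Pi := by
      rw [he, hX]
      calc Pm * E * Pi * (Pm * finSum N₁ N₂ X₁ X₂ * Pi) * (Pm * E * Pi)
            = Pm * E * (Pi * Pm) * finSum N₁ N₂ X₁ X₂ * (Pi * Pm) * E * Pi := by simp only [Matrix.mul_assoc]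
        _ = Pm * (E * finSum N₁ N₂ X₁ X₂ * E) * Pi := by rw [hPiP]; simp only [Matrix.mul_one, Matrix.mul_assoc]
    have h2 : (1 : Matrix (Fin (N₁ + N₂)) (Fin (N₁ + N₂)) S) - e = Pm * (1 - E) * Pi := by
      rw [he, Matrix.mul_sub, Matrix.sub_mul, Matrix.mul_one, hPPi]
    rw [h1, h2, ← Matrix.add_mul, ← Matrix.mul_add, hE, finSum_mul_finSum₀, finSum_mul_finSum₀, ← finSum_one_one₀, finSum_sub_finSum₀,
      finSum_add_finSum₀, Matrix.one_mul, Matrix.mul_one, Matrix.mul_zero, sub_self, sub_zero, add_zero, zero_add]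
  rw [blockDet_def, htrunc, Matrix.det_mul, Matrix.det_mul, det_finSum₀, Matrix.det_one, mul_one, mul_comm (Pm.det), mul_assoc,
    ← Matrix.det_mul, hPPi, Matrix.det_one, mul_one]

/-- **`blockDet (u • (γ − b•1)) X = det X₁`** for `X P = P (X₁ ⊕ᶠ X₂)` in a frame `γ P = P (a·1 ⊕ᶠ b·1)`, `u (a − b) = 1` — the block determinant
of ★ `SingularObstruction` read in the K1 frame. [cite: Rogawski1990, §3.8 Prop. 3.8.1 p. 37] -/
theorem blockDet_lagrangeIdem_eq_det {P : GL (Fin (N₁ + N₂)) S} {γ X : Matrix (Fin (N₁ + N₂)) (Fin (N₁ + N₂)) S} {a b u : S}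
    (hγP : γ * (P : Matrix (Fin (N₁ + N₂)) (Fin (N₁ + N₂)) S) =
      (P : Matrix (Fin (N₁ + N₂)) (Fin (N₁ + N₂)) S) * finSum N₁ N₂ (a • (1 : Matrix (Fin N₁) (Fin N₁) S)) (b • (1 : Matrix (Fin N₂) (Fin N₂) S)))
    (hu : u * (a - b) = 1) {X₁ : Matrix (Fin N₁) (Fin N₁) S} {X₂ : Matrix (Fin N₂) (Fin N₂) S}
    (hXP : X * (P : Matrix (Fin (N₁ + N₂)) (Fin (N₁ + N₂)) S) = (P : Matrix (Fin (N₁ + N₂)) (Fin (N₁ + N₂)) S) * finSum N₁ N₂ X₁ X₂) :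
    blockDet (u • (γ - b • (1 : Matrix (Fin (N₁ + N₂)) (Fin (N₁ + N₂)) S))) X = X₁.det :=
  blockDet_eq_det_of_frame (lagrangeIdem_mul_frame hγP hu) hXP

/-- **For `X ∈ Z(γ)` the blocks exist and `blockDet (u • (γ − b•1)) X = det X₁`** (`a − b` a unit ⇒ `P⁻¹ X P` commutes with `a·1 ⊕ᶠ b·1`, hence is
block diagonal, ★ `eq_finSum_of_commute`). [cite: Rogawski1990, §3.8 Prop. 3.8.1 p. 37] -/
theorem exists_finSum_blockDet_lagrangeIdem_eq_det {P : GL (Fin (N₁ + N₂)) S} {γ X : Matrix (Fin (N₁ + N₂)) (Fin (N₁ + N₂)) S} {a b u : S}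
    (hγP : γ * (P : Matrix (Fin (N₁ + N₂)) (Fin (N₁ + N₂)) S) =
      (P : Matrix (Fin (N₁ + N₂)) (Fin (N₁ + N₂)) S) * finSum N₁ N₂ (a • (1 : Matrix (Fin N₁) (Fin N₁) S)) (b • (1 : Matrix (Fin N₂) (Fin N₂) S)))
    (hu : u * (a - b) = 1) (hX : X * γ = γ * X) :
    ∃ (X₁ : Matrix (Fin N₁) (Fin N₁) S) (X₂ : Matrix (Fin N₂) (Fin N₂) S),
      X * (P : Matrix (Fin (N₁ + N₂)) (Fin (N₁ + N₂)) S) = (P : Matrix (Fin (N₁ + N₂)) (Fin (N₁ + N₂)) S) * finSum N₁ N₂ X₁ X₂ ∧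
        blockDet (u • (γ - b • (1 : Matrix (Fin (N₁ + N₂)) (Fin (N₁ + N₂)) S))) X = X₁.det := by
  set Pm : Matrix (Fin (N₁ + N₂)) (Fin (N₁ + N₂)) S := (P : Matrix (Fin (N₁ + N₂)) (Fin (N₁ + N₂)) S) with hPm
  set Pi : Matrix (Fin (N₁ + N₂)) (Fin (N₁ + N₂)) S := ((P⁻¹ : GL (Fin (N₁ + N₂)) S) : Matrix (Fin (N₁ + N₂)) (Fin (N₁ + N₂)) S) with hPi
  set D : Matrix (Fin (N₁ + N₂)) (Fin (N₁ + N₂)) S := finSum N₁ N₂ (a • (1 : Matrix (Fin N₁) (Fin N₁) S)) (b • (1 : Matrix (Fin N₂) (Fin N₂) S))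
    with hD
  have hPPi : Pm * Pi = 1 := by rw [hPm, hPi, ← Units.val_mul, mul_inv_cancel, Units.val_one]
  have hPiP : Pi * Pm = 1 := by rw [hPm, hPi, ← Units.val_mul, inv_mul_cancel, Units.val_one]
  have hab : IsUnit (a - b) := IsUnit.of_mul_eq_one_right u hu
  -- `P⁻¹ X P` commutes with `D = P⁻¹ γ P`
  have hDeq : D = Pi * γ * Pm := by rw [Matrix.mul_assoc, hγP, ← Matrix.mul_assoc, hPiP, Matrix.one_mul]
  have hcomm : Pi * X * Pm * D = D * (Pi * X * Pm) := by
    rw [hDeq]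
    calc Pi * X * Pm * (Pi * γ * Pm) = Pi * X * (Pm * Pi) * γ * Pm := by simp only [Matrix.mul_assoc]
      _ = Pi * (γ * X) * Pm := by rw [hPPi, Matrix.mul_one, Matrix.mul_assoc Pi X γ, hX]
      _ = Pi * γ * (Pm * Pi) * X * Pm := by rw [hPPi, Matrix.mul_one]; simp only [Matrix.mul_assoc]
      _ = Pi * γ * Pm * (Pi * X * Pm) := by simp only [Matrix.mul_assoc]
  obtain ⟨X₁, X₂, hX₁₂⟩ := eq_finSum_of_commute hab (Pi * X * Pm) hcomm
  have hXP : X * Pm = Pm * finSum N₁ N₂ X₁ X₂ := by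
    rw [← hX₁₂]
    calc X * Pm = (Pm * Pi) * X * Pm := by rw [hPPi, Matrix.one_mul]
      _ = Pm * (Pi * X * Pm) := by simp only [Matrix.mul_assoc]
  exact ⟨X₁, X₂, hXP, blockDet_lagrangeIdem_eq_det hγP hu hXP⟩

end Frame

end Literature.NumberTheory.Rogawski1990

end
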